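import Summits.Parity.BatemanHorn.Theorems.SoloInformedTwinBalancedSplit
import Summits.Parity.BatemanHorn.Theorems.SoloInformedLogPowerCut

/-!
# SoloInformedTwinBalancedSplitLogCut — the balanced-far-tail form of Hardy–Littlewood for prime
# pairs with the prose's own cut `⌊x/(log x)^A⌋`

Solo unit `solo-Parity-informed` (ideation tier, informed mode), session 44; companion of
`SoloInformedTwinBalancedSplit` (C120); `paper.md` §20 (Theorem 20.1 = (F′), Theorem 20.9 = (F),
Corollary 20.4), CLAIMS C121.

`SoloInformedTwinBalancedSplit.twinPrime_iff_balancedFarSum_isLittleO` holds for every admissible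
cut `y → ∞`, `y log³ y = o(x)`; its typed instance there uses `y = ⌊x^{1-ε}⌋`.  The prose Theorem F
of paper.md §20 is written with the cut `y = x (log x)^{-4}`; this file records that this cut is
admissible (`logPowCut_mul_log_pow_three_isLittleO`, any `A > 3`) and states the typed corollary with
it (`twinPrime_iff_balancedFarTail_logPowCut`), so that its two hypotheses are (F′) = Theorem 20.1
and (F) = Theorem 20.9 VERBATIM, read as `o(x)` statements (both PROSE — Bombieri–Vinogradov for
`μ`-convolutions resp. [Ir14, Thm 1.3] adapted to `μ` — and NOT proved in the kernel).
Nothing analytic is proved here.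
-/

namespace Summit.Parity.BatemanHorn.Theorems

open Finset Filter Asymptotics ArithmeticFunction
open scoped ArithmeticFunction.Moebius Topology
open Literature.NumberTheory.Sieve

/-! ### 1. The prose's own cut `⌊x/(log x)^A⌋`, `A > 3` -/

/-- The cut `⌊x/(log x)^A⌋` (paper.md §20: `A = 4`). -/
noncomputable def logPowCut (A : ℝ) (x : ℕ) : ℕ := ⌊(x : ℝ) / Real.log x ^ A⌋₊

/-- Admissibility of the cut `y = ⌊x/(log x)^A⌋`, `A > 3`, for the twin (`k = 2`) localisation:
`y log³ y = o(x)` (indeed `≤ x (log x)^{3-A}`). -/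
theorem logPowCut_mul_log_pow_three_isLittleO {A : ℝ} (hA : 3 < A) :
    (fun x : ℕ => ((logPowCut A x : ℕ) : ℝ) * Real.log ((logPowCut A x : ℕ) : ℝ) ^ 3)
      =o[atTop] fun x : ℕ => (x : ℝ) := by
  have hlogT : Tendsto (fun x : ℕ => Real.log (x : ℝ)) atTop atTop :=
    Real.tendsto_log_atTop.comp tendsto_natCast_atTop_atTop
  have hdec : Tendsto (fun x : ℕ => Real.log (x : ℝ) ^ (3 - A)) atTop (𝓝 0) := by
    have h := (tendsto_rpow_neg_atTop (by linarith : 0 < A - 3)).comp hlogT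
    refine h.congr fun x => ?_
    simp only [Function.comp_apply]
    rw [neg_sub]
  rw [isLittleO_iff]
  intro c hc
  filter_upwards [(Metric.tendsto_nhds.mp hdec) c hc, eventually_ge_atTop 3] with x hx hx3
  have hX : (3 : ℝ) ≤ x := by exact_mod_cast hx3
  have hX0 : (0 : ℝ) < x := by linarith
  have hl1 : 1 < Real.log (x : ℝ) := by
    have h := Real.exp_one_lt_d9
    rw [Real.lt_log_iff_exp_lt hX0]
    linarith
  have hl0 : 0 < Real.log (x : ℝ) := by linarith
  rw [Real.dist_eq, sub_zero, abs_of_pos (Real.rpow_pos_of_pos hl0 _)] at hx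
  have hpow1 : 1 ≤ Real.log (x : ℝ) ^ A := Real.one_le_rpow hl1.le (by linarith)
  have hYle : ((logPowCut A x : ℕ) : ℝ) ≤ (x : ℝ) / Real.log x ^ A := Nat.floor_le (by positivity)
  have hYx : ((logPowCut A x : ℕ) : ℝ) ≤ x := hYle.trans (div_le_self hX0.le hpow1)
  have hlogY0 : 0 ≤ Real.log ((logPowCut A x : ℕ) : ℝ) := Real.log_natCast_nonneg _
  have hlogY : Real.log ((logPowCut A x : ℕ) : ℝ) ≤ Real.log x := by
    rcases Nat.eq_zero_or_pos (logPowCut A x) with hY0 | hY0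
    · rw [hY0, Nat.cast_zero, Real.log_zero]; exact hl0.le
    · exact Real.log_le_log (by exact_mod_cast hY0) hYx
  have hlog3 : Real.log ((logPowCut A x : ℕ) : ℝ) ^ 3 ≤ Real.log (x : ℝ) ^ 3 :=
    pow_le_pow_left₀ hlogY0 hlogY 3
  rw [Real.norm_eq_abs, Real.norm_eq_abs,
    abs_of_nonneg (mul_nonneg (Nat.cast_nonneg _) (pow_nonneg hlogY0 3)), abs_of_pos hX0]
  calc ((logPowCut A x : ℕ) : ℝ) * Real.log ((logPowCut A x : ℕ) : ℝ) ^ 3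
        ≤ ((x : ℝ) / Real.log x ^ A) * Real.log (x : ℝ) ^ 3 :=
        mul_le_mul hYle hlog3 (pow_nonneg hlogY0 3) (by positivity)
    _ = Real.log (x : ℝ) ^ (3 - A) * x := by
        rw [Real.rpow_sub hl0, Real.rpow_ofNat]
        field_simp
    _ ≤ c * x := mul_le_mul_of_nonneg_right hx.le hX0.le

/-- **Typed corollary with the prose's cut** `y = ⌊x/(log x)^A⌋`, `A > 3` (paper.md §20: `A = 4`):
with this cut the hypotheses are EXACTLY (F′) = Theorem 20.1 and (F) = Theorem 20.9 of paper.md,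
read as `o(x)` statements (both PROSE, not kernel), and the conclusion is Corollary 20.4:
`π₂(x) ~ 2C₂x/log²x ⟺` the balanced far tail `min(e₁,e₂) > x^{1/2-ε₀}`, `e₁e₂ > x^{1+η}` is `o(x)`. -/
theorem twinPrime_iff_balancedFarTail_logPowCut {A : ℝ} (hA : 3 < A) {ε₀ η : ℝ}
    (hU : (fun x => twinUnbalancedSum x (logPowCut A x) (balanceCut ε₀ x))
      =o[atTop] fun x : ℕ => (x : ℝ))
    (hW : (fun x => twinBalancedWindowSum x (logPowCut A x) (balanceCut ε₀ x) (productLevel η x))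
      =o[atTop] fun x : ℕ => (x : ℝ)) :
    (fun x : ℕ => (twinPrimeCount x : ℝ)) ~[atTop]
        (fun x : ℕ => 2 * twinPrimeConst * x / Real.log x ^ 2) ↔
      (fun x => twinBalancedFarSum x (logPowCut A x) (balanceCut ε₀ x) (productLevel η x))
        =o[atTop] fun x : ℕ => (x : ℝ) :=
  twinPrime_iff_balancedFarSum_isLittleO (y := logPowCut A) (z := balanceCut ε₀) (Y := productLevel η)
    (tendsto_logPowCut_atTop (by linarith : 0 < A)) (logPowCut_mul_log_pow_three_isLittleO hA) hU hW

end Summit.Parity.BatemanHorn.Theorems
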